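import Mathlib
import HarnessLib
import Literature.Analysis.FluidPDE.VorticityCalculus
import Summits.NavierStokesRegularity.NavierStokesRegularity.Theses.LoopPeriodRatchet
import Summits.NavierStokesRegularity.NavierStokesRegularity.Theorems.LocalSineTubeDoorProfileAlignedWindowRigidity
import Summits.NavierStokesRegularity.NavierStokesRegularity.Theorems.LocalSineTubeDoorProfileAlignedWindowRigidityAncient
import Summits.NavierStokesRegularity.NavierStokesRegularity.Theorems.PoloidalWindowDoorPoloidalWindowRigidityAxisymmetric
import Summits.NavierStokesRegularity.NavierStokesRegularity.Theorems.PoloidalWindowDoorPoloidalWindowRigidityFlat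

/-!
# Crux `FrequencyGrowthExponent` (stmt-NavierStokesRegularity-27893), negative side:
# the settled strata carry no vortex loop (where a witness `W` cannot live)

Negative-side (cdisprove, D-0016) bookkeeping for the wall `LoopPeriodRatchet.FrequencyGrowthExponent`; nothing here
closes or changes any item (`--supports`).  By `Negative/LoadBearing` and the refutation criterion of the companion
reductions (`¬ FrequencyGrowthExponent ↔` «some e₃-poloidal Type-I Oseen-mild ancient profile carries a non-stationary
closed vortex line»), refuting the wall means CONSTRUCTING such a profile `W`.  This file records, as kernel-checked
corollaries of theorems already in the tree, four strata of the class on which the slice vorticity vanishes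
identically at every negative time — so every vortex line there is stationary and `W` must lie OFF all of them:

* `curl_eq_zero_of_translate_invariant` — slices invariant along a fixed direction `e ≠ 0` (horizontal: the planar
  Type-I Liouville theorem (N₁); vertical: columnar / two-dimensional profiles), via
  `…LocalSineTubeDoorProfileAlignedWindowRigidity.eq_zero_of_translate_eq`;
* `curl_eq_zero_of_aligned_window` — the vorticity of ONE slice is parallel to a fixed direction on a non-empty open
  set (in particular the unidirectional-vorticity stratum), via `….eq_zero_of_aligned_window` (slices are real-analytic);
* `eq_zero_of_flat`, `curl_eq_zero_of_flat` — poloidal profiles that are flat in the horizontal direction `e₀`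
  (`∂₀ v₂ ≡ 0` on every slice), the composite inside `…PoloidalWindowRigidityFlat.stub_flatStratum`
  (`translate_eq_of_flat_poloidal` + (N₁)), here with the conclusion `v ≡ 0` exposed;
* `curl_eq_zero_of_axisymmetric` — poloidal profiles with axisymmetric slices about the `e₃`-axis
  (`ω₃ ≡ 0` & axisymmetric ⟹ swirl-free, then KNSS 2009 Thm 5.2), via
  `…PoloidalWindowRigidityAxisymmetric.eq_zero_of_axisymmetric_noSwirl` / `hasNoSwirl_of_poloidal_axisymmetric`.

Consequently (`no_nonstationary_vortexLine_of_curl_eq_zero`) the loop hypothesis of the wall is never met on these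
strata: the wall holds there vacuously, and the construction target `W` is non-axisymmetric, nowhere locally
aligned, not flat and not invariant under any translation.

HONEST FRAMING: corollaries of landed theorems, recorded for the W-census of the negation-first reading (req192);
nothing here bears on `PoloidalWindowDoor.Target` or on Navier–Stokes regularity.
-/

noncomputable section

-- the summit and its single sub-problem share the name (CONVENTIONS §1), as in every Theorems file
set_option linter.dupNamespace false

namespace Summit.NavierStokesRegularity.NavierStokesRegularity.Theorems.FrequencyGrowthExponent.Negative

open Set Function Filter Topology
open scoped RealInnerProductSpace InnerProductSpace
open Literature.Analysis Literature.Analysis.FluidPDE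
open Summit.NavierStokesRegularity.NavierStokesRegularity.Theorems.LocalSineTubeDoorProfileAlignedWindowRigidityAncient
open Summit.NavierStokesRegularity.NavierStokesRegularity.Theorems.LocalSineTubeDoorProfileAlignedWindowRigidity
open Summit.NavierStokesRegularity.NavierStokesRegularity.Theorems.PoloidalWindowDoorPoloidalWindowRigidityAxisymmetric
open Summit.NavierStokesRegularity.NavierStokesRegularity.Theorems.PoloidalWindowDoorPoloidalWindowRigidityFlat

variable {C : ℝ} {v : ℝ → EuclideanSpace ℝ (Fin 3) → EuclideanSpace ℝ (Fin 3)}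

/-! ### Stationary vortex lines of a vanishing profile -/

/-- A profile vanishing on the past has identically vanishing slice vorticity. -/
theorem curl_eq_zero_of_eq_zero (hzero : ∀ t < 0, ∀ y, v t y = 0) : ∀ t < 0, ∀ y, curl (v t) y = 0 := by
  intro t ht y
  have h : v t = fun _ => 0 := funext (hzero t ht)
  rw [h, curl_fun_zero]

/-- If the slice vorticity vanishes identically, every vortex line of the slice (every solution of
`c′ = curl v(t) ∘ c`) is stationary: the loop hypothesis `∃ s, curl (v t) (c s) ≠ 0` of the wall is never met. -/
theorem no_nonstationary_vortexLine_of_curl_eq_zero (hcurl : ∀ t < 0, ∀ y, curl (v t) y = 0) {t : ℝ} (ht : t < 0)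
    (c : ℝ → EuclideanSpace ℝ (Fin 3)) : ¬ ∃ s, curl (v t) (c s) ≠ 0 := by
  rintro ⟨s, hs⟩
  exact hs (hcurl t ht (c s))

/-! ### Stratum 1: slices invariant along a fixed direction -/

/-- **Translation-invariant profiles carry no vorticity.** A profile of the class (Type-I time rate, continuity on
the open past slab, unit-viscosity Oseen–Duhamel identity, divergence-free slices) whose slices are invariant along a
fixed direction `e ≠ 0` vanishes identically (`eq_zero_of_translate_eq`), so its slice vorticity is zero. -/
theorem curl_eq_zero_of_translate_invariant (hrate : HasTypeITimeDecay C v)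
    (hcont : ContinuousOn (uncurry v) (Iio (0 : ℝ) ×ˢ univ))
    (hmild : ∀ s t : ℝ, s < t → t < 0 → ∀ y : EuclideanSpace ℝ (Fin 3),
      v t y = UnboundedOperators.heatExtension (v s) (t - s) y - oseenDuhamel 1 s v v t y)
    (hdiv : ∀ t < 0, VectorCalculus.IsDivFree (v t)) {e : EuclideanSpace ℝ (Fin 3)} (he : e ≠ 0)
    (hinv : ∀ t < 0, ∀ (y : EuclideanSpace ℝ (Fin 3)) (l : ℝ), v t (y + l • e) = v t y) :
    ∀ t < 0, ∀ y, curl (v t) y = 0 :=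
  curl_eq_zero_of_eq_zero (eq_zero_of_translate_eq hrate hcont hmild hdiv he hinv)

/-! ### Stratum 2: a locally aligned vorticity window -/

/-- **A locally aligned slice kills the profile.** If on ONE slice `s < 0` the vorticity is parallel to a fixed
direction `e ≠ 0` on a non-empty open set, the profile vanishes identically (`eq_zero_of_aligned_window`: slices are
real-analytic, alignment propagates, and the aligned stratum is settled), so no slice carries vorticity. -/
theorem curl_eq_zero_of_aligned_window (hrate : HasTypeITimeDecay C v)
    (hcont : ContinuousOn (uncurry v) (Iio (0 : ℝ) ×ˢ univ))
    (hmild : ∀ s t : ℝ, s < t → t < 0 → ∀ y : EuclideanSpace ℝ (Fin 3),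
      v t y = UnboundedOperators.heatExtension (v s) (t - s) y - oseenDuhamel 1 s v v t y)
    (hdiv : ∀ t < 0, VectorCalculus.IsDivFree (v t)) {s : ℝ} (hs : s < 0) {e : EuclideanSpace ℝ (Fin 3)}
    (he : e ≠ 0) {U : Set (EuclideanSpace ℝ (Fin 3))} (hU : IsOpen U) (hne : U.Nonempty)
    (hal : ∀ y ∈ U, cross (curl (v s) y) e = 0) : ∀ t < 0, ∀ y, curl (v t) y = 0 :=
  curl_eq_zero_of_eq_zero (eq_zero_of_aligned_window hrate hcont hmild hdiv hs he hU hne hal)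

/-! ### Stratum 3: flat poloidal profiles -/

/-- **Flat poloidal profiles vanish.** A profile of the class, poloidal along `e₃` and flat in the direction `e₀`
(`∂₀ v₂ ≡ 0` on every slice), vanishes identically: every slice is invariant along `e₀`
(`translate_eq_of_flat_poloidal`, fed by the slice gradient bound), and Stratum 1 concludes.  (The composite
inside `stub_flatStratum`, with the conclusion `v ≡ 0` exposed.) -/
theorem eq_zero_of_flat (hrate : HasTypeITimeDecay C v)
    (hcont : ContinuousOn (uncurry v) (Iio (0 : ℝ) ×ˢ univ))
    (hmild : ∀ s t : ℝ, s < t → t < 0 → ∀ y : EuclideanSpace ℝ (Fin 3),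
      v t y = UnboundedOperators.heatExtension (v s) (t - s) y - oseenDuhamel 1 s v v t y)
    (hdiv : ∀ t < 0, VectorCalculus.IsDivFree (v t))
    (hpol : ∀ s < 0, ∀ y, ⟪curl (v s) y, EuclideanSpace.single 2 1⟫_ℝ = 0)
    (hflat : ∀ s < 0, ∀ y, fderiv ℝ (v s) y (EuclideanSpace.single 0 1) 2 = 0) :
    ∀ t < 0, ∀ y, v t y = 0 := by
  have hbdd := bdd_of_hasTypeITimeDecay hrate
  have hinv : ∀ s < 0, ∀ (y : EuclideanSpace ℝ (Fin 3)) (l : ℝ),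
      v s (y + l • (EuclideanSpace.single 0 1 : EuclideanSpace ℝ (Fin 3))) = v s y := by
    intro s hs y l
    have hC3 : ContDiff ℝ 3 (v s) := (analyticOnNhd_slice hcont hbdd hmild hs).contDiff
    obtain ⟨B, hB⟩ := hbdd (-s / 2) (by linarith)
    obtain ⟨M', hM'⟩ := exists_fderiv_slice_bound hcont hbdd hmild hs
    exact translate_eq_of_flat_poloidal hC3 (hdiv s hs) (fun y => hB s (by linarith) y) hM'
      (fun y => by simpa [EuclideanSpace.inner_single_right] using hpol s hs y) (hflat s hs) y l
  have hne : (EuclideanSpace.single 0 1 : EuclideanSpace ℝ (Fin 3)) ≠ 0 := fun h0 => by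
    simpa using congrArg (fun w : EuclideanSpace ℝ (Fin 3) => w 0) h0
  exact eq_zero_of_translate_eq hrate hcont hmild hdiv hne hinv

/-- The flat poloidal stratum carries no vorticity. -/
theorem curl_eq_zero_of_flat (hrate : HasTypeITimeDecay C v)
    (hcont : ContinuousOn (uncurry v) (Iio (0 : ℝ) ×ˢ univ))
    (hmild : ∀ s t : ℝ, s < t → t < 0 → ∀ y : EuclideanSpace ℝ (Fin 3),
      v t y = UnboundedOperators.heatExtension (v s) (t - s) y - oseenDuhamel 1 s v v t y)
    (hdiv : ∀ t < 0, VectorCalculus.IsDivFree (v t))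
    (hpol : ∀ s < 0, ∀ y, ⟪curl (v s) y, EuclideanSpace.single 2 1⟫_ℝ = 0)
    (hflat : ∀ s < 0, ∀ y, fderiv ℝ (v s) y (EuclideanSpace.single 0 1) 2 = 0) :
    ∀ t < 0, ∀ y, curl (v t) y = 0 :=
  curl_eq_zero_of_eq_zero (eq_zero_of_flat hrate hcont hmild hdiv hpol hflat)

/-! ### Stratum 4: axisymmetric poloidal profiles -/

/-- **Axisymmetric poloidal profiles carry no vorticity.** A profile of the class, poloidal along `e₃`, with slices
axisymmetric about the `e₃`-axis, is swirl-free (`hasNoSwirl_of_poloidal_axisymmetric`) and hence vanishes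
identically (`eq_zero_of_axisymmetric_noSwirl`, KNSS 2009 Thm 5.2 in the Type-I gauge). -/
theorem curl_eq_zero_of_axisymmetric (hrate : HasTypeITimeDecay C v)
    (hcont : ContinuousOn (uncurry v) (Iio (0 : ℝ) ×ˢ univ))
    (hmild : ∀ s t : ℝ, s < t → t < 0 → ∀ y : EuclideanSpace ℝ (Fin 3),
      v t y = UnboundedOperators.heatExtension (v s) (t - s) y - oseenDuhamel 1 s v v t y)
    (hdiv : ∀ t < 0, VectorCalculus.IsDivFree (v t))
    (hpol : ∀ s < 0, ∀ y, ⟪curl (v s) y, EuclideanSpace.single 2 1⟫_ℝ = 0)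
    (haxi : ∀ s < 0, IsAxisymmetric (v s)) : ∀ t < 0, ∀ y, curl (v t) y = 0 :=
  curl_eq_zero_of_eq_zero (eq_zero_of_axisymmetric_noSwirl hrate hcont hmild hdiv haxi
    (hasNoSwirl_of_poloidal_axisymmetric hrate hcont hmild hpol haxi))

end Summit.NavierStokesRegularity.NavierStokesRegularity.Theorems.FrequencyGrowthExponent.Negative

end
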